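/-
Copyright: cell pub-rosobs (carver-g58). INSTRUMENT for engine 1's W(f) toy model — NOT a resolution theorem.
-/
import Mathlib.Algebra.MvPolynomial.PDeriv
import Mathlib.Algebra.MvPolynomial.Monad
import Mathlib.Algebra.MvPolynomial.CommRing
import Mathlib.Algebra.BigOperators.Group.Finset.Basic
import Mathlib.Tactic.Ring
import HarnessLib

/-!
# Weight-½ classes are spectators (PROPOSITION H, isotropy half): `V ↦ V + δ` preserving `q₂(V) + g₁` has `B(V, δ) = 0`

INSTRUMENT, NOT a resolution theorem and NOT a statement about the Abramovich–Temkin–Włodarczyk invariant: the "compare the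
`V`-linear parts" step of engine 1's PROPOSITION H (weight-½ splitting) for the `W(f)` TOY MODEL of cell pub-rosobs
(THEOREM-LT-eng1-g38 §13), typed as plain commutative algebra over any commutative ring `K`.  The engine's statement is typed as
hypotheses → conclusion; nothing internally minted is cited as a fact.  AI-written Lean; AI review is weaker than expert review.

Setting: slots `ι`, a finite set `V ⊆ ι` (the weight-½ class), `quadForm V b = Σ_{i,j ∈ V} b_{ij} X_i X_j` with a SYMMETRIC table `b`,
and `g₁` free of the `V`-variables.  A `K`-algebra endomorphism `Φ` with `Φ(X_v) = X_v + δ_v`, `δ_v` free of `V` (`v ∈ V`), and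
`Φ(X_l)` free of `V` for `l ∉ V` — the shape of a graded isotropy, all other weights being `< ½` — which FIXES `quadForm V b + g₁`
satisfies `2 Σ_j b_{vj} δ_j = 0` for every `v ∈ V` (`two_mul_sum_eq_zero_of_fix`: apply `∂_v`; `∂_v Φ(g₁) = 0`, `∂_v` of the shifted
form is `2 Σ_j b_{vj}(X_j + δ_j)`), hence `δ = 0` on `V` as soon as `2` is a unit and `b|_{V×V}` has a left inverse (`delta_eq_zero_of_fix`,
"`q₂` nondegenerate").  v2 (carver-g59, section `NormalForm`; the decls above it are unchanged): the NORMAL-FORM half —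
the graded change `shiftV V s : V_i ↦ V_i − s_i` satisfies `q₂(V − s) = q₂(V) − 2Σ_i V_i(Σ_j b_{ij}s_j) + q₂(s)` (`shiftV_quadForm`,
`b` symmetric), so `r_i = 2Σ_j b_{ij} s_j` kills the `V`-linear terms `Σ_i V_i r_i` (`normalForm`), and such an `s` exists, free of `V`,
when `2` is a unit and `b|_{V×V}` has a left inverse (`two_mul_sum_solve`, `normalForm_of_nondegenerate`: `g ↦ q₂(V) + g₁'`, `g₁'`
free of `V`).  NOT here: "(P) for `V` ⇔ `q₂` nondegenerate" (needs `WeightedCentreInvariantDirection`).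

References: derivations / partial derivatives of polynomial rings [cite: Lang2002, Ch. IV §1]; weighted blow-up context
[cite: AbramovichTemkinWlodarczyk2024, §5]; the proposition is engine 1's (THEOREM-LT-eng1-g38 §13, PROPOSITION H), formalisation ours.
-/

open MvPolynomial

namespace Literature.AlgebraicGeometry.Resolution.WeightedBlowup

namespace QuadraticSpectator

variable {K : Type*} [CommRing K] {ι : Type*}

/-- The quadratic form `Σ_{i,j ∈ V} b_{ij} X_i X_j` on the slots `V`. [cite: Lang2002, Ch. IV §1] -/
noncomputable def quadForm (V : Finset ι) (b : ι → ι → K) : MvPolynomial ι K :=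
  ∑ i ∈ V, ∑ j ∈ V, C (b i j) * X i * X j

/-- `∂_v Σ_{i,j∈V} b_{ij} Y_i Y_j = 2 Σ_j b_{vj} Y_j` for a symmetric `b`, whenever `∂_v Y_i = [i = v]` on `V` (`v ∈ V`).
(bookkeeping) [cite: Lang2002, Ch. IV §1] -/
theorem pderiv_quad_of [DecidableEq ι] (V : Finset ι) (b : ι → ι → K) (hb : ∀ i j, b i j = b j i) {v : ι} (hv : v ∈ V)
    (Y : ι → MvPolynomial ι K) (hY : ∀ i ∈ V, pderiv v (Y i) = if i = v then 1 else 0) :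
    pderiv v (∑ i ∈ V, ∑ j ∈ V, C (b i j) * Y i * Y j) = 2 * ∑ j ∈ V, C (b v j) * Y j := by
  have h1 : ∀ i ∈ V, ∀ j ∈ V, pderiv v (C (b i j) * Y i * Y j)
      = (if i = v then C (b i j) * Y j else 0) + (if j = v then C (b i j) * Y i else 0) := by
    intro i hi j hj
    simp only [pderiv_mul, pderiv_C, hY i hi, hY j hj, zero_mul, zero_add]
    split_ifs <;> ring
  rw [map_sum]
  have h2 : ∀ i ∈ V, pderiv v (∑ j ∈ V, C (b i j) * Y i * Y j)
      = (if i = v then ∑ j ∈ V, C (b i j) * Y j else 0) + ∑ j ∈ V, (if j = v then C (b i j) * Y i else 0) := by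
    intro i hi
    rw [map_sum, Finset.sum_congr rfl (fun j hj => h1 i hi j hj), Finset.sum_add_distrib]
    congr 1
    split_ifs
    · rfl
    · exact Finset.sum_const_zero
  rw [Finset.sum_congr rfl h2, Finset.sum_add_distrib, Finset.sum_ite_eq' V v, if_pos hv]
  have h3 : ∀ i ∈ V, ∑ j ∈ V, (if j = v then C (b i j) * Y i else 0) = C (b v i) * Y i := by
    intro i _
    rw [Finset.sum_ite_eq' V v, if_pos hv, hb]
  rw [Finset.sum_congr rfl h3, two_mul]

/-- `∂_v quadForm V b = 2 Σ_j b_{vj} X_j` (`v ∈ V`, `b` symmetric). [cite: Lang2002, Ch. IV §1] -/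
theorem pderiv_quadForm [DecidableEq ι] (V : Finset ι) (b : ι → ι → K) (hb : ∀ i j, b i j = b j i) {v : ι} (hv : v ∈ V) :
    pderiv v (quadForm V b) = 2 * ∑ j ∈ V, C (b v j) * X j :=
  pderiv_quad_of V b hb hv X fun i _ => by rw [pderiv_X, Pi.single_apply]

/-- An algebra endomorphism is the substitution of the images of the variables. (bookkeeping) [cite: Lang2002, Ch. IV §1] -/
theorem algHom_eq_bind₁ (Φ : MvPolynomial ι K →ₐ[K] MvPolynomial ι K) (F : MvPolynomial ι K) :
    Φ F = bind₁ (fun i => Φ (X i)) F := by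
  conv_lhs => rw [aeval_unique Φ]
  rfl

/-- If `g₁` is free of the `V`-variables and `Φ` maps every variable OCCURRING in `g₁` to a `V`-free polynomial, then `Φ g₁` is
`V`-free. (bookkeeping) [cite: Lang2002, Ch. IV §1] -/
theorem notMem_vars_map_of_free [DecidableEq ι] (V : Finset ι) (Φ : MvPolynomial ι K →ₐ[K] MvPolynomial ι K)
    (g₁ : MvPolynomial ι K) (hg₁ : ∀ v ∈ V, v ∉ g₁.vars) (hΦL : ∀ l, l ∉ V → ∀ u ∈ V, u ∉ (Φ (X l)).vars)
    {u : ι} (hu : u ∈ V) : u ∉ (Φ g₁).vars := by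
  rw [algHom_eq_bind₁]
  intro h
  obtain ⟨l, hl, hul⟩ := Finset.mem_biUnion.mp (vars_bind₁ _ _ h)
  have hlV : l ∉ V := fun hlV => hg₁ l hlV hl
  exact hΦL l hlV u hu hul

/-- **PROPOSITION H, isotropy half — the `V`-linear parts** (engine 1, THEOREM-LT §13): with `b` symmetric, `g₁` free of `V`,
`Φ(X_v) = X_v + δ_v` (`δ_v` free of `V`) for `v ∈ V` and `Φ(X_l)` free of `V` for `l ∉ V`, the identity
`Φ(quadForm V b + g₁) = quadForm V b + g₁` forces `2 Σ_{j∈V} b_{vj} δ_j = 0` for every `v ∈ V`.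
(engine statement typed as hypotheses → conclusion) [cite: Lang2002, Ch. IV §1] -/
theorem two_mul_sum_eq_zero_of_fix [DecidableEq ι] (V : Finset ι) (b : ι → ι → K) (hb : ∀ i j, b i j = b j i)
    (g₁ : MvPolynomial ι K) (hg₁ : ∀ v ∈ V, v ∉ g₁.vars)
    (Φ : MvPolynomial ι K →ₐ[K] MvPolynomial ι K) (δ : ι → MvPolynomial ι K)
    (hΦV : ∀ v ∈ V, Φ (X v) = X v + δ v) (hδ : ∀ v ∈ V, ∀ u ∈ V, u ∉ (δ v).vars)
    (hΦL : ∀ l, l ∉ V → ∀ u ∈ V, u ∉ (Φ (X l)).vars)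
    (hfix : Φ (quadForm V b + g₁) = quadForm V b + g₁) {v : ι} (hv : v ∈ V) :
    2 * ∑ j ∈ V, C (b v j) * δ j = 0 := by
  have hD := congrArg (pderiv v) hfix
  rw [map_add, map_add, map_add, pderiv_quadForm V b hb hv,
    pderiv_eq_zero_of_notMem_vars (hg₁ v hv),
    pderiv_eq_zero_of_notMem_vars (notMem_vars_map_of_free V Φ g₁ hg₁ hΦL hv), add_zero, add_zero] at hD
  have hΦq : Φ (quadForm V b) = ∑ i ∈ V, ∑ j ∈ V, C (b i j) * (X i + δ i) * (X j + δ j) := by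
    unfold quadForm
    simp only [map_sum, map_mul, algHom_C, algebraMap_eq]
    refine Finset.sum_congr rfl fun i hi => Finset.sum_congr rfl fun j hj => ?_
    rw [hΦV i hi, hΦV j hj]
  have hY : ∀ i ∈ V, pderiv v (X i + δ i) = if i = v then 1 else 0 := by
    intro i hi
    rw [map_add, pderiv_X, Pi.single_apply, pderiv_eq_zero_of_notMem_vars (hδ i hi v hv), add_zero]
  rw [hΦq, pderiv_quad_of V b hb hv (fun i => X i + δ i) hY] at hD
  have : 2 * ∑ j ∈ V, C (b v j) * (X j + δ j) = 2 * ∑ j ∈ V, C (b v j) * X j + 2 * ∑ j ∈ V, C (b v j) * δ j := by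
    rw [← mul_add, ← Finset.sum_add_distrib]
    congr 1
    exact Finset.sum_congr rfl fun j _ => by ring
  rw [this] at hD
  exact add_eq_left.mp hD

/-- **PROPOSITION H, isotropy half** (engine 1, THEOREM-LT §13): under the hypotheses of `two_mul_sum_eq_zero_of_fix`, if `2` is a unit of
`K` and the table `b` restricted to `V × V` has a left inverse `b'` ("`q₂` nondegenerate"), then `δ_v = 0` for every `v ∈ V` — a graded
isotropy fixes the weight-½ class pointwise. (engine statement typed as hypotheses → conclusion) [cite: Lang2002, Ch. IV §1] -/
theorem delta_eq_zero_of_fix [DecidableEq ι] (V : Finset ι) (b : ι → ι → K) (hb : ∀ i j, b i j = b j i)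
    (b' : ι → ι → K) (hb' : ∀ i ∈ V, ∀ k ∈ V, ∑ j ∈ V, b' i j * b j k = if i = k then 1 else 0) (h2 : IsUnit (2 : K))
    (g₁ : MvPolynomial ι K) (hg₁ : ∀ v ∈ V, v ∉ g₁.vars)
    (Φ : MvPolynomial ι K →ₐ[K] MvPolynomial ι K) (δ : ι → MvPolynomial ι K)
    (hΦV : ∀ v ∈ V, Φ (X v) = X v + δ v) (hδ : ∀ v ∈ V, ∀ u ∈ V, u ∉ (δ v).vars)
    (hΦL : ∀ l, l ∉ V → ∀ u ∈ V, u ∉ (Φ (X l)).vars)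
    (hfix : Φ (quadForm V b + g₁) = quadForm V b + g₁) {v : ι} (hv : v ∈ V) :
    δ v = 0 := by
  obtain ⟨u, hu⟩ := h2
  -- cancel the unit `2`
  have hlin : ∀ i ∈ V, ∑ j ∈ V, C (b i j) * δ j = 0 := by
    intro i hi
    have h := congrArg (fun F => C ((↑u⁻¹ : K)) * F) (two_mul_sum_eq_zero_of_fix V b hb g₁ hg₁ Φ δ hΦV hδ hΦL hfix hi)
    simp only [mul_zero] at h
    rwa [← mul_assoc, show (2 : MvPolynomial ι K) = C (2 : K) from (map_ofNat C 2).symm, ← map_mul, ← hu,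
      Units.inv_mul, C_1, one_mul] at h
  -- apply the left inverse
  have key : ∑ i ∈ V, C (b' v i) * (∑ j ∈ V, C (b i j) * δ j) = δ v := by
    have e1 : ∀ i ∈ V, C (b' v i) * (∑ j ∈ V, C (b i j) * δ j) = ∑ j ∈ V, C (b' v i * b i j) * δ j := by
      intro i _
      rw [Finset.mul_sum]
      exact Finset.sum_congr rfl fun j _ => by rw [map_mul, mul_assoc]
    rw [Finset.sum_congr rfl e1, Finset.sum_comm]
    have e2 : ∀ j ∈ V, ∑ i ∈ V, C (b' v i * b i j) * δ j = (if v = j then 1 else 0) * δ j := by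
      intro j hj
      rw [← Finset.sum_mul, ← map_sum, hb' v hv j hj]
      split_ifs <;> simp
    rw [Finset.sum_congr rfl e2]
    simp only [ite_mul, one_mul, zero_mul, Finset.sum_ite_eq V v, if_pos hv]
  rw [← key]
  exact Finset.sum_eq_zero fun i hi => by rw [hlin i hi, mul_zero]

/-! ## Normal form: completing the square (v2, carver-g59) -/

section NormalForm

variable [DecidableEq ι] (V : Finset ι) (b : ι → ι → K)

/-- The change of variables `V_i ↦ V_i − s_i` for `i ∈ V`, identity on the other slots (engine 1: the graded triangular change of
PROPOSITION H, `s_i` of weight ½ in lighter variables). (construction, ours) [cite: Lang2002, Ch. IV §1] -/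
noncomputable def shiftV (s : ι → MvPolynomial ι K) : MvPolynomial ι K →ₐ[K] MvPolynomial ι K :=
  bind₁ fun i => if i ∈ V then X i - s i else X i

variable (s : ι → MvPolynomial ι K)

/-- `shiftV` on a `V`-slot. (bookkeeping) [cite: Lang2002, Ch. IV §1] -/
theorem shiftV_X_of_mem {i : ι} (hi : i ∈ V) : shiftV V s (X i) = X i - s i := by
  rw [shiftV, bind₁_X_right, if_pos hi]

/-- `shiftV` on a lighter slot. (bookkeeping) [cite: Lang2002, Ch. IV §1] -/
theorem shiftV_X_of_notMem {i : ι} (hi : i ∉ V) : shiftV V s (X i) = X i := by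
  rw [shiftV, bind₁_X_right, if_neg hi]

/-- `shiftV` fixes the scalars. (bookkeeping) [cite: Lang2002, Ch. IV §1] -/
@[simp] theorem shiftV_C (c : K) : shiftV V s (C c) = C c := by
  rw [shiftV, bind₁_C_right]

/-- `shiftV` fixes every `V`-free polynomial. (bookkeeping) [cite: Lang2002, Ch. IV §1] -/
theorem shiftV_eq_self_of_notMem_vars (F : MvPolynomial ι K) (hF : ∀ u ∈ V, u ∉ F.vars) : shiftV V s F = F := by
  have hC : (shiftV V s : MvPolynomial ι K →ₐ[K] MvPolynomial ι K).toRingHom.comp C = (RingHom.id (MvPolynomial ι K)).comp C := by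
    ext c
    simp
  have hv : ∀ i, i ∈ F.vars → i ∈ F.vars →
      (shiftV V s : MvPolynomial ι K →ₐ[K] MvPolynomial ι K).toRingHom (X i) = (RingHom.id (MvPolynomial ι K)) (X i) := by
    intro i hi _
    have hiV : i ∉ V := fun hiV => hF i hiV hi
    simp [shiftV_X_of_notMem V s hiV]
  simpa using hom_congr_vars hC hv rfl

/-- **Completing the square — the identity** (derived here): for a SYMMETRIC table `b` and any `s`,
`q₂(V − s) = q₂(V) − 2 Σ_{i∈V} V_i (Σ_{j∈V} b_{ij} s_j) + q₂(s)`. [cite: Lang2002, Ch. IV §1] -/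
theorem shiftV_quadForm (hb : ∀ i j, b i j = b j i) :
    shiftV V s (quadForm V b) = quadForm V b - 2 * ∑ i ∈ V, X i * (∑ j ∈ V, C (b i j) * s j)
      + ∑ i ∈ V, ∑ j ∈ V, C (b i j) * s i * s j := by
  have hΦ : shiftV V s (quadForm V b) = ∑ i ∈ V, ∑ j ∈ V, C (b i j) * (X i - s i) * (X j - s j) := by
    unfold quadForm
    rw [map_sum]
    refine Finset.sum_congr rfl fun i hi => ?_
    rw [map_sum]
    refine Finset.sum_congr rfl fun j hj => ?_
    rw [map_mul, map_mul, shiftV_C, shiftV_X_of_mem V s hi, shiftV_X_of_mem V s hj]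
  have hexp : ∀ i ∈ V, ∀ j ∈ V, C (b i j) * (X i - s i) * (X j - s j)
      = C (b i j) * X i * X j - C (b i j) * X i * s j - C (b i j) * s i * X j + C (b i j) * s i * s j := by
    intros
    ring
  have hcross : ∑ i ∈ V, ∑ j ∈ V, C (b i j) * s i * X j = ∑ i ∈ V, ∑ j ∈ V, C (b i j) * X i * s j := by
    rw [Finset.sum_comm]
    exact Finset.sum_congr rfl fun i _ => Finset.sum_congr rfl fun j _ => by rw [hb j i]; ring
  have hA : ∑ i ∈ V, X i * ∑ j ∈ V, C (b i j) * s j = ∑ i ∈ V, ∑ j ∈ V, C (b i j) * X i * s j :=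
    Finset.sum_congr rfl fun i _ => by rw [Finset.mul_sum]; exact Finset.sum_congr rfl fun j _ => by ring
  rw [hΦ, Finset.sum_congr rfl fun i hi => Finset.sum_congr rfl fun j hj => hexp i hi j hj]
  simp only [Finset.sum_add_distrib, Finset.sum_sub_distrib]
  rw [hcross, hA, quadForm]
  ring

/-- **Completing the square** (derived here): if `r_i = 2 Σ_j b_{ij} s_j` for `i ∈ V`, then
`q₂(V − s) + Σ_i (V_i − s_i) r_i = q₂(V) + (q₂(s) − Σ_i s_i r_i)` — the `V`-linear terms are gone. [cite: Lang2002, Ch. IV §1] -/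
theorem shiftV_quadForm_add_linear (hb : ∀ i j, b i j = b j i) (r : ι → MvPolynomial ι K)
    (hr : ∀ i ∈ V, r i = 2 * ∑ j ∈ V, C (b i j) * s j) :
    shiftV V s (quadForm V b) + ∑ i ∈ V, (X i - s i) * r i
      = quadForm V b + (∑ i ∈ V, ∑ j ∈ V, C (b i j) * s i * s j - ∑ i ∈ V, s i * r i) := by
  have hlin : ∑ i ∈ V, (X i - s i) * r i = 2 * ∑ i ∈ V, X i * (∑ j ∈ V, C (b i j) * s j) - ∑ i ∈ V, s i * r i := by
    rw [Finset.mul_sum, ← Finset.sum_sub_distrib]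
    exact Finset.sum_congr rfl fun i hi => by rw [hr i hi]; ring
  rw [shiftV_quadForm V b s hb, hlin]
  ring

/-- **PROPOSITION H, normal-form half** (engine 1, THEOREM-LT §13; derived here as hypotheses → conclusion): for
`g = q₂(V) + Σ_{i∈V} V_i r_i + g₁` with `r_i`, `g₁` free of `V` and `s` solving `r_i = 2 Σ_j b_{ij} s_j`, the change `V_i ↦ V_i − s_i`
gives `g ↦ q₂(V) + (q₂(s) − Σ_i s_i r_i + g₁)`. [cite: Lang2002, Ch. IV §1] -/
theorem normalForm (hb : ∀ i j, b i j = b j i) (r : ι → MvPolynomial ι K) (g₁ : MvPolynomial ι K)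
    (hr : ∀ i ∈ V, r i = 2 * ∑ j ∈ V, C (b i j) * s j) (hrV : ∀ i ∈ V, ∀ u ∈ V, u ∉ (r i).vars)
    (hg₁ : ∀ u ∈ V, u ∉ g₁.vars) :
    shiftV V s (quadForm V b + ∑ i ∈ V, X i * r i + g₁)
      = quadForm V b + (∑ i ∈ V, ∑ j ∈ V, C (b i j) * s i * s j - ∑ i ∈ V, s i * r i + g₁) := by
  have hsum : ∑ i ∈ V, shiftV V s (X i * r i) = ∑ i ∈ V, (X i - s i) * r i :=
    Finset.sum_congr rfl fun i hi => by
      rw [map_mul, shiftV_X_of_mem V s hi, shiftV_eq_self_of_notMem_vars V s (r i) (hrV i hi)]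
  rw [map_add, map_add, shiftV_eq_self_of_notMem_vars V s g₁ hg₁, map_sum, hsum,
    shiftV_quadForm_add_linear V b s hb r hr]
  ring

/-- The new `V`-free tail is indeed free of `V` when `s`, `r`, `g₁` are. (bookkeeping) [cite: Lang2002, Ch. IV §1] -/
theorem notMem_vars_normalForm_tail (r : ι → MvPolynomial ι K) (g₁ : MvPolynomial ι K)
    (hsV : ∀ i ∈ V, ∀ u ∈ V, u ∉ (s i).vars) (hrV : ∀ i ∈ V, ∀ u ∈ V, u ∉ (r i).vars) (hg₁ : ∀ u ∈ V, u ∉ g₁.vars)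
    {u : ι} (hu : u ∈ V) :
    u ∉ (∑ i ∈ V, ∑ j ∈ V, C (b i j) * s i * s j - ∑ i ∈ V, s i * r i + g₁).vars := by
  intro h
  rcases Finset.mem_union.mp (vars_add_subset _ _ h) with h | h
  · rcases Finset.mem_union.mp (vars_sub_subset _ h) with h | h
    · obtain ⟨i, hi, h⟩ := Finset.mem_biUnion.mp (vars_sum_subset _ _ h)
      obtain ⟨j, hj, h⟩ := Finset.mem_biUnion.mp (vars_sum_subset _ _ h)
      rcases Finset.mem_union.mp (vars_mul _ _ h) with h | h
      · rcases Finset.mem_union.mp (vars_mul _ _ h) with h | h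
        · rw [vars_C] at h
          exact Finset.notMem_empty _ h
        · exact hsV i hi u hu h
      · exact hsV j hj u hu h
    · obtain ⟨i, hi, h⟩ := Finset.mem_biUnion.mp (vars_sum_subset _ _ h)
      rcases Finset.mem_union.mp (vars_mul _ _ h) with h | h
      · exact hsV i hi u hu h
      · exact hrV i hi u hu h
  · exact hg₁ u hu h

/-- **Solving `2 B s = r`** (derived here): with `2 = u` a unit and `b'` a left inverse of `b|_{V×V}` (`b` symmetric),
`s_j := u⁻¹ Σ_{l∈V} b'_{lj} r_l` satisfies `2 Σ_{j∈V} b_{ij} s_j = r_i` for `i ∈ V`. [cite: Lang2002, Ch. IV §1] -/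
theorem two_mul_sum_solve (hb : ∀ i j, b i j = b j i) (b' : ι → ι → K)
    (hb' : ∀ i ∈ V, ∀ k ∈ V, ∑ j ∈ V, b' i j * b j k = if i = k then 1 else 0) (u : Kˣ) (hu : (u : K) = 2)
    (r : ι → MvPolynomial ι K) {i : ι} (hi : i ∈ V) :
    2 * ∑ j ∈ V, C (b i j) * (C (↑u⁻¹ : K) * ∑ l ∈ V, C (b' l j) * r l) = r i := by
  have h2 : (2 : MvPolynomial ι K) * C (↑u⁻¹ : K) = 1 := by
    rw [show (2 : MvPolynomial ι K) = C (2 : K) from (map_ofNat C 2).symm, ← map_mul, ← hu, Units.mul_inv, C_1]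
  have e1 : ∀ j ∈ V, C (b i j) * (C (↑u⁻¹ : K) * ∑ l ∈ V, C (b' l j) * r l)
      = ∑ l ∈ V, C (↑u⁻¹ : K) * (C (b' l j * b j i) * r l) := by
    intro j _
    rw [Finset.mul_sum, Finset.mul_sum]
    exact Finset.sum_congr rfl fun l _ => by rw [map_mul, hb j i]; ring
  have e2 : ∀ l ∈ V, ∑ j ∈ V, C (↑u⁻¹ : K) * (C (b' l j * b j i) * r l) = C (↑u⁻¹ : K) * ((if l = i then 1 else 0) * r l) := by
    intro l hl
    rw [← Finset.mul_sum, ← Finset.sum_mul, ← map_sum, hb' l hl i hi]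
    split_ifs <;> simp
  rw [Finset.sum_congr rfl e1, Finset.sum_comm, Finset.sum_congr rfl e2, ← Finset.mul_sum, ← mul_assoc, h2, one_mul]
  simp only [ite_mul, one_mul, zero_mul, Finset.sum_ite_eq' V i, if_pos hi]

/-- **PROPOSITION H, normal-form half, from nondegeneracy** (engine 1, THEOREM-LT §13; derived here): if `2` is a unit of `K`,
`b` is symmetric with `b|_{V×V}` left-invertible ("`q₂` nondegenerate") and `r_i`, `g₁` are free of `V`, then there is `s`, free of
`V`, with `shiftV V s (q₂(V) + Σ_{i∈V} V_i r_i + g₁) = q₂(V) + g₁'` and `g₁'` free of `V` — "weight-½ classes are pure spectators".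
[cite: Lang2002, Ch. IV §1] -/
theorem normalForm_of_nondegenerate (hb : ∀ i j, b i j = b j i) (b' : ι → ι → K)
    (hb' : ∀ i ∈ V, ∀ k ∈ V, ∑ j ∈ V, b' i j * b j k = if i = k then 1 else 0) (h2 : IsUnit (2 : K))
    (r : ι → MvPolynomial ι K) (g₁ : MvPolynomial ι K) (hrV : ∀ i ∈ V, ∀ u ∈ V, u ∉ (r i).vars)
    (hg₁ : ∀ u ∈ V, u ∉ g₁.vars) :
    ∃ s : ι → MvPolynomial ι K, (∀ i ∈ V, ∀ u ∈ V, u ∉ (s i).vars) ∧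
      ∃ g₁' : MvPolynomial ι K, (∀ u ∈ V, u ∉ g₁'.vars) ∧
        shiftV V s (quadForm V b + ∑ i ∈ V, X i * r i + g₁) = quadForm V b + g₁' := by
  obtain ⟨u, hu⟩ := h2
  set s : ι → MvPolynomial ι K := fun j => C (↑u⁻¹ : K) * ∑ l ∈ V, C (b' l j) * r l with hs
  have hsr : ∀ i ∈ V, r i = 2 * ∑ j ∈ V, C (b i j) * s j := fun i hi =>
    (two_mul_sum_solve V b hb b' hb' u hu r hi).symm
  have hsV : ∀ i ∈ V, ∀ v ∈ V, v ∉ (s i).vars := by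
    intro j _ v hv h
    rcases Finset.mem_union.mp (vars_mul _ _ h) with h | h
    · rw [vars_C] at h
      exact Finset.notMem_empty _ h
    · obtain ⟨l, hl, h⟩ := Finset.mem_biUnion.mp (vars_sum_subset _ _ h)
      rcases Finset.mem_union.mp (vars_mul _ _ h) with h | h
      · rw [vars_C] at h
        exact Finset.notMem_empty _ h
      · exact hrV l hl v hv h
  exact ⟨s, hsV, _, fun v hv => notMem_vars_normalForm_tail V b s r g₁ hsV hrV hg₁ hv,
    normalForm V b s hb r g₁ hsr hrV hg₁⟩

end NormalForm

end QuadraticSpectator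

end Literature.AlgebraicGeometry.Resolution.WeightedBlowup
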